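import Summits.ResolutionOfSingularities.ResolutionOfSingularities.Theorems.FrobeniusClosingSteerChartMonomialSubst
import Summits.ResolutionOfSingularities.ResolutionOfSingularities.Theorems.FrobeniusClosingSteerPowerSeriesParity
import Literature.RingTheory.MvPowerSeries.MaximalIdealPow
import HarnessLib

/-!
# Crux `Steer` (stmt-ResolutionOfSingularities-16345), chain W4.1, Lemma S kernel `…NoSatelliteStep`, stages (α)(β)(γ)(Σ) — the SUPPORT KILL in
# `K⟦x, y, z_k⟧` at a rational satellite step (power-series level)

OURS (campaign `res-hironaka`, rung L ★L-G4, slot W4.1; seat res-L0-w41-stub-2 g6 = Lemma S heir, res-L0-w41-plan-1 RULINGs 163a/181c; spec =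
res-D-pv-007's `NoSatelliteStep-PLAN.md` stages (α)(β)(γ)(Σ) over his K2 kit (`…ChartMonomialSubst` p536416, `…PowerSeriesParity` p535264), res-L0-w41-idea-3
`NT-DIRECT.md` §1 and res-L0-w41-tri-2 `gpd/audit_GPERF_DIRECT.md` §1 (the exhaustive inequality, `d ≥ 4`); replaces the role of no printed item; NOT a statement
of the manuscript under review [claim: Hironaka2017, status: under-review]; AI-produced). Theses-free, definition-free. Letters `σ = Fin (m+2)`: `0 ↔ x`
(the old exceptional parameter `X`), `1 ↔ y` (the satellite chart letter), `k+2 ↔ z_k`.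

* `NoSatelliteSupport.degree_expSum_chart` — total degree under the chart exponent map at letter `j`, weight `M`: `|g·e| = |e| + M·Σ_{i≠j} e i`;
* `NoSatelliteSupport.coeff_eq_zero_of_odd_of_sub_sq_mem_pow` — (β): `F − G² ∈ 𝔪^n` kills the ODD monomials of `F` of degree `< n`;
* `NoSatelliteSupport.coeff_eq_zero_of_odd_of_eq_sq_add_X_pow_mul` — (γ, downstairs): `Φ = A² + y^n·R`, `R ∈ 𝔪^n` kills the odd monomials of `Φ` of degree `< 2n`;
* `NoSatelliteSupport.le_degree_expSum_of_transport` — (γ, transport): if the odd monomials of `λ_*(F(x^g))` of degree `< N` vanish (injective exponent map,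
  parity-reflecting, `λ` injective on coefficients) then every odd monomial `e` of `F` has `N ≤ |g·e|`;
* `NoSatelliteSupport.two_le_of_constraints` — (Σ): the three inequalities force `x`-plus-`z`-degree `≥ 2` (`d ≥ 4`, `omega`);
* `NoSatelliteSupport.odd_support_of_window` — **all together**: realisability `x^d·F = H(x, xy, xz)`, order `F − G² ∈ 𝔪^d`, and the satellite reading
  `λ_*(F(x′y, y, w y)) = A² + y^d R`, `R ∈ 𝔪^d`, `d ≥ 4` ⟹ every ODD monomial of `F` has `Σ_{t ≠ y} e t ≥ 2` — the input of res-D-pv-007's (N)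
  `NoSatelliteStep.not_hasIsolatedSingularity_of_odd_support` with `T = {t ≠ y}`, `#T = m + 1 < m + 2`. [folklore]
-/

noncomputable section

set_option linter.dupNamespace false

open MvPowerSeries
open Literature.RingTheory.MvPowerSeries Literature.RingTheory.MvPowerSeries.monoidPowerSeries
open Summit.ResolutionOfSingularities.ResolutionOfSingularities.Theorems.SwitchingDichotomy.ChartMonomialSubst
open Summit.ResolutionOfSingularities.ResolutionOfSingularities.Theorems.SwitchingDichotomy.PowerSeriesParity

namespace Summit.ResolutionOfSingularities.ResolutionOfSingularities.Theorems.SwitchingDichotomy.NoSatelliteSupport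

/-- **Total degree under the chart exponent map** at the persisting letter `j` with weight `M`: `|expSum g e| = |e| + M · Σ_{i ≠ j} e i`. [folklore] -/
theorem degree_expSum_chart {σ : Type*} [Fintype σ] [DecidableEq σ] (j : σ) (M : ℕ) (e : σ →₀ ℕ) :
    (expSum (fun i : σ => Finsupp.single i 1 + if i = j then 0 else M • Finsupp.single j 1) e).degree =
      e.degree + M * ∑ i ∈ Finset.univ.erase j, e i := by
  rw [Finsupp.degree_eq_sum, Finsupp.degree_eq_sum, ← Finset.add_sum_erase _ _ (Finset.mem_univ j),
    ← Finset.add_sum_erase _ (fun i => e i) (Finset.mem_univ j), expSum_chart_apply_self,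
    Finset.sum_congr rfl fun i hi => expSum_chart_apply_of_ne j M e (Finset.ne_of_mem_erase hi)]
  ring

section Field

variable {σ : Type} [Fintype σ] [DecidableEq σ] {K K' : Type} [Field K] [Field K'] [CharP K 2] [CharP K' 2]

omit [Fintype σ] [DecidableEq σ] in
/-- **(β)** If `F − G² ∈ 𝔪^n` then every ODD monomial of `F` of total degree `< n` has zero coefficient (squares have only even monomials in
characteristic `2`). [folklore] -/
theorem coeff_eq_zero_of_odd_of_sub_sq_mem_pow {F G : MvPowerSeries σ K} {n : ℕ} (h : F - G ^ 2 ∈ IsLocalRing.maximalIdeal (MvPowerSeries σ K) ^ n)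
    {e : σ →₀ ℕ} (hodd : ∃ i, Odd (e i)) (hdeg : e.degree < n) : coeff e F = 0 := by
  rw [← coeff_sub_sq_of_odd F G hodd]
  exact Jets.coeff_eq_zero_of_mem_maximalIdeal_pow h hdeg

omit [DecidableEq σ] in
/-- **(γ, downstairs)** If `Φ = A² + X_j^n · R` with `R ∈ 𝔪^n` then every ODD monomial of `Φ` of total degree `< 2n` has zero coefficient. [folklore] -/
theorem coeff_eq_zero_of_odd_of_eq_sq_add_X_pow_mul {Φ A R : MvPowerSeries σ K'} {j : σ} {n : ℕ}
    (hR : R ∈ IsLocalRing.maximalIdeal (MvPowerSeries σ K') ^ n) (h : Φ = A ^ 2 + X j ^ n * R)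
    {e : σ →₀ ℕ} (hodd : ∃ i, Odd (e i)) (hdeg : e.degree < 2 * n) : coeff e Φ = 0 := by
  have hmem : X j ^ n * R ∈ IsLocalRing.maximalIdeal (MvPowerSeries σ K') ^ (2 * n) := by
    rw [two_mul, pow_add]
    refine Ideal.mul_mem_mul ?_ hR
    rw [X_pow_eq]
    exact Jets.monomial_mem_maximalIdeal_pow (by simp [Finsupp.degree_eq_sum]) 1
  have : Φ - A ^ 2 = X j ^ n * R := by rw [h]; ring
  rw [← coeff_sub_sq_of_odd Φ A hodd, this]
  exact Jets.coeff_eq_zero_of_mem_maximalIdeal_pow hmem hdeg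

omit [CharP K 2] [CharP K' 2] in
/-- **(γ, transport)** along `λ_* ∘ (F ↦ F(x^g))` for the chart at letter `j` (injective, parity-reflecting exponent map; `λ` injective on
coefficients): if the odd monomials of `λ_*(F(x^g))` of degree `< N` vanish, then every odd monomial `e` of `F` has `N ≤ |g·e|`. [folklore] -/
theorem le_degree_expSum_of_transport (lam : K →+* K') (j : σ) (M : ℕ) (F : MvPowerSeries σ K) {N : ℕ}
    (hΦ : ∀ e' : σ →₀ ℕ, (∃ i, Odd (e' i)) → e'.degree < N →
      coeff e' (MvPowerSeries.map lam (substGenerators (R := K)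
        (fun i : σ => Finsupp.single i 1 + if i = j then 0 else M • Finsupp.single j 1) (chartExp_ne_zero j M) F)) = 0)
    {e : σ →₀ ℕ} (hodd : ∃ i, Odd (e i)) (he : coeff e F ≠ 0) :
    N ≤ (expSum (fun i : σ => Finsupp.single i 1 + if i = j then 0 else M • Finsupp.single j 1) e).degree := by
  by_contra hlt
  rw [not_le] at hlt
  apply he
  -- the image monomial is odd
  have hodd' : ∃ i, Odd (expSum (fun i : σ => Finsupp.single i 1 + if i = j then 0 else M • Finsupp.single j 1) e i) := by
    by_contra hall
    push Not at hall
    obtain ⟨i, hi⟩ := hodd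
    have h2 : ∀ s, 2 ∣ expSum (fun i : σ => Finsupp.single i 1 + if i = j then 0 else M • Finsupp.single j 1) e s :=
      fun s => even_iff_two_dvd.mp (Nat.not_odd_iff_even.mp (hall s))
    exact (Nat.not_even_iff_odd.mpr hi) (even_iff_two_dvd.mpr (dvd_of_dvd_expSum_chart j M 2 e h2 i))
  have h := hΦ _ hodd' hlt
  rw [coeff_map, coeff_substGenerators_chart_expSum, map_eq_zero_iff lam lam.injective] at h
  exact h

/-- **(Σ)** the exhaustive inequality (res-L0-w41-tri-2 audit §1, `d ≥ 4`): with `a = e 0`, `b = e 1`, `|e| = a + b + c`, the constraints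
(α) `b + c ≤ a + d`, (β) `d ≤ |e|`, (γ) `2d ≤ |e| + (a + c)` force `a + c ≥ 2`. [folklore] -/
theorem two_le_of_constraints {a b D d S₀ S₁ : ℕ} (hd : 4 ≤ d) (hab : a + b ≤ D) (hS₀ : D = a + S₀) (hS₁ : D = b + S₁)
    (hα : S₀ ≤ a + d) (hβ : d ≤ D) (hγ : 2 * d ≤ D + S₁) : 2 ≤ S₁ := by
  omega

/-- **The support kill at a rational satellite step.** In `K⟦x, y, z_k⟧` (`σ = Fin (m+2)`, `x ↔ 0`, `y ↔ 1`), characteristic `2`: if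
(α) `x^d · F = H(x, x·y, x·z)` (realisability from the previous member), (β) `F − G² ∈ 𝔪^d` (cleaned order at this member), and (γ) after the SATELLITE
substitution `x ↦ x′y, z_k ↦ w_k y` and a change of coefficients `λ`, `λ_*(F(x′y, y, wy)) = A² + y^d · R` with `R ∈ 𝔪^d` (cleaned order at the next
member), `d ≥ 4`, then every ODD monomial `e` of `F` has `Σ_{t ≠ y} e t ≥ 2`. [folklore] -/
theorem odd_support_of_window {m d : ℕ} (hd : 4 ≤ d) (lam : K →+* K') {F G H : MvPowerSeries (Fin (m + 2)) K}
    {A R : MvPowerSeries (Fin (m + 2)) K'}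
    (hα : X 0 ^ d * F = substGenerators (R := K)
      (fun i : Fin (m + 2) => Finsupp.single i 1 + if i = 0 then 0 else 1 • Finsupp.single 0 1) (chartExp_ne_zero 0 1) H)
    (hβ : F - G ^ 2 ∈ IsLocalRing.maximalIdeal (MvPowerSeries (Fin (m + 2)) K) ^ d)
    (hR : R ∈ IsLocalRing.maximalIdeal (MvPowerSeries (Fin (m + 2)) K') ^ d)
    (hγ : MvPowerSeries.map lam (substGenerators (R := K)
      (fun i : Fin (m + 2) => Finsupp.single i 1 + if i = 1 then 0 else 1 • Finsupp.single 1 1) (chartExp_ne_zero 1 1) F) =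
        A ^ 2 + X 1 ^ d * R) :
    ∀ e : Fin (m + 2) →₀ ℕ, (∃ i, Odd (e i)) → coeff e F ≠ 0 → 2 ≤ ∑ t ∈ Finset.univ.erase 1, e t := by
  intro e hodd he
  -- (α)
  have h1 : 1 * ∑ i ∈ Finset.univ.erase 0, e i ≤ e 0 + d := mul_sum_le_add_of_X_pow_mul_eq_substGenerators 0 1 hα he
  -- (β)
  have h2 : d ≤ e.degree := by
    by_contra hlt
    exact he (coeff_eq_zero_of_odd_of_sub_sq_mem_pow hβ hodd (not_le.mp hlt))
  -- (γ)
  have h3 := le_degree_expSum_of_transport lam 1 1 F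
    (fun e' hodd' hdeg' => coeff_eq_zero_of_odd_of_eq_sq_add_X_pow_mul hR hγ hodd' hdeg') hodd he
  rw [degree_expSum_chart] at h3
  -- bookkeeping
  have hS₀ : e.degree = e 0 + ∑ i ∈ Finset.univ.erase 0, e i := by
    rw [Finsupp.degree_eq_sum, ← Finset.add_sum_erase _ _ (Finset.mem_univ (0 : Fin (m + 2)))]
  have hS₁ : e.degree = e 1 + ∑ i ∈ Finset.univ.erase 1, e i := by
    rw [Finsupp.degree_eq_sum, ← Finset.add_sum_erase _ _ (Finset.mem_univ (1 : Fin (m + 2)))]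
  have hab : e 0 + e 1 ≤ e.degree := by
    rw [hS₁, ← Finset.add_sum_erase _ _ (Finset.mem_erase.mpr ⟨Fin.zero_ne_one, Finset.mem_univ (0 : Fin (m + 2))⟩)]
    omega
  exact two_le_of_constraints hd hab hS₀ hS₁ (by simpa using h1) h2 (by omega)

end Field

end Summit.ResolutionOfSingularities.ResolutionOfSingularities.Theorems.SwitchingDichotomy.NoSatelliteSupport

end
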